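import Summits.CriticalPhenomena.PercolationContinuityZ3.Theorems.SahiMasterFamilyHFlatLin

/-!
# The QUARTER BOUND on the top-free union-closed hull: the typed conjecture Q(n), `Q(n) ⟹ (UC-hull)_n`, Q(2) with its extremiser

Unit `prim-masterthm-p4` (gen 19; crux anchor stmt-CriticalPhenomena-4575, helper work; memo
`run/shared/lean/prim/prim-masterthm/prim-masterthm-p4/P4-GEN19-REPORT.md` §3).  Companion of `…GHConjecture` (`UCHullNonneg`), `…HFlat`, `…SDHFlat*`, `…Bilin`.

The TOP-FREE hull on `Fin n`: finite mixtures `β = Σ_x w_x 1_{𝒰_x}` of indicator functions of union-closed families `𝒰_x` of subsets of `Fin n`, with `univ`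
NOT required to belong to the families (so the top defect `1 − β_univ ∈ [0,1]` is free).  Unlike the hull with top, this class is closed under restriction to a
subset of the ground set — the restriction of a hull point to `R` is a top-free hull point on `R` — which is exactly the operation every induction on the
master-family functionals needs (memo §3, DELETION-PICTURE.md §6).
* `QuarterBound n` — **CONJECTURE Q(n)** (conjecture-valued definition, never a fact): on the top-free hull
     `Φ_n(β) + ¼·(n−1)!·(1 − β_univ) ≥ 0`,
  i.e. in defect variables `W_R(d) − A_R(d) ≤ ¼(n−1)!·d_R`: the all-bad excess of a set over its co-points is at most a quarter of its full-cycle mass.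
  At `β_univ = 1` it is `(UC-hull)_n` (`ucHullNonneg_of_quarterBound`).  EVIDENCE (memo §3): the constant ¼ is ATTAINED for every n ≥ 2 by the antipodal
  principal pair `𝒰_1 = {S : i ∈ S, j ∉ S}`, `𝒰_2 = {S : j ∈ S, i ∉ S}` with weights ½, ½ (exact check n ≤ 8), and no larger ratio was found: n = 2, 3, 4 by
  hill-climbing over mixtures of ALL union-closed families (7 / 61 / 2 480 of them), n = 5, 6 over random families, and over ≈ 10⁴ hull points of the BILIN tests
  (k ≤ 7).  On the linear relaxation box + pairwise union the constant is NOT ¼ (≥ 0.31 at n = 3); adding the co-point inequalities restores ¼ numerically (n ≤ 5).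
* `quarterBound_two` — Q(2), using only the pairwise-union inequality `β_0 + β_1 ≤ 1 + β_{01}` of the hull (`(p+q)² ≤ (1+u)² ≤ 1+3u`), and
  `quarterBound_two_tight` — equality at the antipodal pair on two points (`β_0 = β_1 = ½`, `β_{01} = 0`, `Φ_2 = −¼`).
HONEST FRAMING: a typed conjecture with its smallest case; Q(n) (n ≥ 3), (UC-hull)_k (k ≥ 8), Sahi's `C_k` and the master theorem remain OPEN.  Axioms standard. [this work]
-/

noncomputable section

open scoped Classical

namespace Summit.CriticalPhenomena.PercolationContinuityZ3.Theorems

namespace TopFree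

open Finset
open Literature.Combinatorics.Sahi2008
open PrincipalCapBeta (phiSet)
open GHConjecture (UCHullNonneg)

variable {n : ℕ}

/-- **Conjecture Q(n)** — the quarter bound on the top-free union-closed hull: `Φ_n(β) + ¼·(n−1)!·(1 − β_univ) ≥ 0` for every finite mixture `β` of indicators of
union-closed families (containing `univ` or not).  A conjecture-valued definition, never a fact. [this work] [status: n = 2 kernel; sharp (attained) every n; open n ≥ 3] -/
@[conjecture] def QuarterBound (n : ℕ) : Prop :=
  ∀ (α : Type) [Fintype α] (w : α → ℝ) (𝒰 : α → Finset (Finset (Fin n))),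
    (∀ x, 0 ≤ w x) → ∑ x, w x = 1 → (∀ x, ∀ A ∈ 𝒰 x, ∀ A' ∈ 𝒰 x, A ∪ A' ∈ 𝒰 x) →
      0 ≤ phiSet n (fun S => ∑ x, w x * (if S ∈ 𝒰 x then (1 : ℝ) else 0))
            + (1 / 4) * ((n - 1).factorial : ℝ) * (1 - ∑ x, w x * (if (univ : Finset (Fin n)) ∈ 𝒰 x then (1 : ℝ) else 0))

/-- **Q(n) ⟹ (UC-hull)_n**: when every family contains `univ` the correction term vanishes. [this work] -/
theorem ucHullNonneg_of_quarterBound (hQ : QuarterBound n) : UCHullNonneg n := by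
  intro α _ w 𝒰 hw0 hw1 hUC htop
  have h := hQ α w 𝒰 hw0 hw1 hUC
  have h1 : (∑ x, w x * (if (univ : Finset (Fin n)) ∈ 𝒰 x then (1 : ℝ) else 0)) = 1 := HFlat.mixture_univ w 𝒰 hw1 htop
  have h2 : (1 : ℝ) / 4 * ((n - 1).factorial : ℝ) * (1 - ∑ x, w x * (if (univ : Finset (Fin n)) ∈ 𝒰 x then (1 : ℝ) else 0)) = 0 := by
    rw [h1, sub_self, mul_zero]
  linarith

/-- The real inequality behind Q(2): `u − p·q + ¼(1 − u) ≥ 0` for `p, q, u ∈ [0,1]` with `p + q ≤ 1 + u`. [this work] -/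
theorem quarter_two_poly {p q u : ℝ} (hp0 : 0 ≤ p) (hq0 : 0 ≤ q) (hu0 : 0 ≤ u) (hu1 : u ≤ 1)
    (hpu : p + q ≤ 1 + u) : 0 ≤ u - p * q + 1 / 4 * (1 - u) := by
  nlinarith [sq_nonneg (p - q), mul_nonneg hp0 hq0, mul_nonneg hu0 (sub_nonneg.2 hu1),
    mul_le_mul (hpu) (hpu) (add_nonneg hp0 hq0) (by linarith)]

/-- **Q(2)**: on two points the quarter bound follows from the pairwise-union inequality of the hull alone. [this work] -/
theorem quarterBound_two : QuarterBound 2 := by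
  intro α _ w 𝒰 hw0 hw1 hUC
  set β : Finset (Fin 2) → ℝ := fun S => ∑ x, w x * (if S ∈ 𝒰 x then (1 : ℝ) else 0) with hβ
  have e01 : ({0} : Finset (Fin 2)) ∪ {1} = univ := by decide
  have hu : β {0} + β {1} ≤ 1 + β univ := by
    have := SDHFlat.mixture_add_le_one_add_union w 𝒰 hw0 hw1 hUC {0} {1}
    rwa [e01] at this
  have hp0 : 0 ≤ β {0} := HFlat.mixture_nonneg w 𝒰 hw0 {0}
  have hq0 : 0 ≤ β {1} := HFlat.mixture_nonneg w 𝒰 hw0 {1}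
  have hu0 : 0 ≤ β univ := HFlat.mixture_nonneg w 𝒰 hw0 univ
  have hu1 : β univ ≤ 1 := HSharp.mixture_le_one w 𝒰 hw0 hw1 univ
  have hΦ : phiSet 2 β = β univ - β {0} * β {1} := PrincipalCapBeta.phiSet_two β
  show 0 ≤ phiSet 2 β + 1 / 4 * ((2 - 1).factorial : ℝ) * (1 - β univ)
  have hf : ((2 - 1).factorial : ℝ) = 1 := by norm_num
  rw [hΦ, hf]
  have := quarter_two_poly hp0 hq0 hu0 hu1 hu
  linarith

/-- **Q(2) is sharp**: the antipodal pair `𝒰_true = {{0}}`, `𝒰_false = {{1}}` with weights ½, ½ gives `β_0 = β_1 = ½`, `β_univ = 0` and EQUALITY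
`Φ_2(β) + ¼(1 − β_univ) = −¼ + ¼ = 0`. [this work] -/
theorem quarterBound_two_tight :
    phiSet 2 (fun S => ∑ x : Bool, (1 / 2 : ℝ) * (if S ∈ (if x then ({{0}} : Finset (Finset (Fin 2))) else {{1}}) then (1 : ℝ) else 0))
      + (1 / 4) * ((2 - 1).factorial : ℝ)
        * (1 - ∑ x : Bool, (1 / 2 : ℝ) * (if (univ : Finset (Fin 2)) ∈ (if x then ({{0}} : Finset (Finset (Fin 2))) else {{1}}) then (1 : ℝ) else 0)) = 0 := by
  rw [PrincipalCapBeta.phiSet_two]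
  have hu0 : (univ : Finset (Fin 2)) ∉ ({{0}} : Finset (Finset (Fin 2))) := by decide
  have hu1 : (univ : Finset (Fin 2)) ∉ ({{1}} : Finset (Finset (Fin 2))) := by decide
  have h00 : ({0} : Finset (Fin 2)) ∈ ({{0}} : Finset (Finset (Fin 2))) := by decide
  have h01 : ({0} : Finset (Fin 2)) ∉ ({{1}} : Finset (Finset (Fin 2))) := by decide
  have h10 : ({1} : Finset (Fin 2)) ∉ ({{0}} : Finset (Finset (Fin 2))) := by decide
  have h11 : ({1} : Finset (Fin 2)) ∈ ({{1}} : Finset (Finset (Fin 2))) := by decide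
  simp only [Fintype.sum_bool, if_true, if_false, Bool.false_eq_true, hu0, hu1, h00, h01, h10, h11]
  norm_num

end TopFree

end Summit.CriticalPhenomena.PercolationContinuityZ3.Theorems
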